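import Mathlib
import Summits.ValiantsHypothesis.ValiantsHypothesis.Theses.LiouvilleSarnak
import Summits.ValiantsHypothesis.ValiantsHypothesis.Theorems.LiouvilleSarnakAlignedTypeITransposedHolds
import Summits.ValiantsHypothesis.ValiantsHypothesis.Theorems.LiouvilleSarnakLiouvilleCutRankBlockEntropy

/-!
# Route LiouvilleSarnak — crux `DigitalBilinearLiouville` (stmt-ValiantsHypothesis-14774):
# COARSE digital rectangles have discrepancy `o(4^n)` under EVERY cut

The crux is equivalent to "`λ` has discrepancy `o(4^n)` on every digital combinatorial rectangle
`A × B` of every balanced cut `π`" (tree: `digitalBilinearLiouville_iff_rectangles`).  The tree's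
unconditional families so far (`rectangles_fullRows_of_lowRows`, its column twin) require the cut to
give its lowest `L(ε)` positions to one letter.  This file removes every condition on the cut and puts it
on the rectangle instead:

* ★ `rectangles_coarse` — for every `ε > 0` there is `L` such that for every `n`, EVERY balanced cut `π`
  of the `2n` positions (`L ≤ 2n`) and all sets `A`, `B` of row / column digit strings that are COARSE at
  scale `L` (membership does not depend on the digits sitting at positions `< L`),
  `|Σ_{r ∈ A} Σ_{c ∈ B} λ(N_π(r, c) + 1)| ≤ ε · 4^n`.
  Proof: `(r, c) ↦ N_π(r, c)` is a bijection onto `[0, 4^n)`; a coarse rectangle is a union of full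
  fibres of `N ↦ ⌊N / 2^L⌋`, i.e. of aligned blocks `[2^L H, 2^L (H + 1))`, so the sum is a sum of
  block sums of `λ`, and `Σ_{H < 4^n / 2^L} |Σ_{a < 2^L} λ(2^L H + a + 1)| ≤ ε 4^n` by Matomäki–Radziwiłł
  (tree: `Transposed.sum_abs_dyadicBlockSum_le`, PROVED).

So, for every cut, the crux lives entirely in FINE rectangles (those that feel the lowest `L(ε)` digits).
Honest framing: unconditional enlargement of the solved rectangle class; `DigitalBilinearLiouville`,
`LiouvilleCutRank`, `AlgebraicSarnak` stay OPEN; nothing here bears on VP versus VNP.  No definitions.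
-/

-- the directory `ValiantsHypothesis/ValiantsHypothesis` repeats the summit name (tree layout)
set_option linter.dupNamespace false

namespace Summit.ValiantsHypothesis.ValiantsHypothesis.Theorems.LiouvilleSarnakDigitalBilinearLiouville.Coarse

open Finset ArithmeticFunction

open Summit.ValiantsHypothesis.ValiantsHypothesis.Theorems.LiouvilleSarnak.AlignedTypeI.Transposed
  (sum_abs_dyadicBlockSum_le)
open Summit.ValiantsHypothesis.ValiantsHypothesis.Theorems.LiouvilleSarnakLiouvilleCutRank.BlockEntropy
  (exists_cutPair_eq)

/-- Bits of the cut number: bit `j` of `N_π(r, c)` is the row digit or column digit sitting at position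
`j`. [folklore] -/
theorem testBit_cutNumber' (n : ℕ) (π : Fin n ⊕ Fin n ≃ Fin (2 * n)) (r c : Fin n → Bool)
    (j : Fin (2 * n)) :
    (Nat.ofBits (fun j : Fin (2 * n) => Sum.elim r c (π.symm j))).testBit j =
      Sum.elim r c (π.symm j) := by
  rw [Nat.testBit_ofBits_lt _ _ j.isLt]

/-- ★ **Coarse rectangles have discrepancy `o(4^n)`, for every cut.**  For every `ε > 0` there is `L`
such that for every `n`, every balanced cut `π` of the `2n` bit positions with `L ≤ 2n`, and all finite
sets `A`, `B` of row / column digit strings whose membership does not depend on the digits at positions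
`< L` of `π`, one has `|Σ_{r ∈ A} Σ_{c ∈ B} λ(N_π(r, c) + 1)| ≤ ε · 4^n`.
[cite: MatomakiRadziwillAnnals2016, Theorem 1] -/
theorem rectangles_coarse :
    ∀ ε : ℝ, 0 < ε → ∃ L : ℕ, ∀ n : ℕ, ∀ π : Fin n ⊕ Fin n ≃ Fin (2 * n), L ≤ 2 * n →
      ∀ A B : Finset (Fin n → Bool),
        (∀ r ∈ A, ∀ r' : Fin n → Bool,
          (∀ i : Fin n, L ≤ (π (Sum.inl i) : ℕ) → r' i = r i) → r' ∈ A) →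
        (∀ c ∈ B, ∀ c' : Fin n → Bool,
          (∀ i : Fin n, L ≤ (π (Sum.inr i) : ℕ) → c' i = c i) → c' ∈ B) →
        |∑ r ∈ A, ∑ c ∈ B, ((liouville
          (Nat.ofBits (fun j : Fin (2 * n) => Sum.elim r c (π.symm j)) + 1) : ℤ) : ℝ)| ≤
          ε * 4 ^ n := by
  classical
  intro ε hε
  obtain ⟨L, hL⟩ := sum_abs_dyadicBlockSum_le hε
  refine ⟨L, fun n π hLn A B hA hB => ?_⟩
  -- notation: the cut number and its values on the rectangle
  set N : (Fin n → Bool) × (Fin n → Bool) → ℕ := fun p =>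
    Nat.ofBits (fun j : Fin (2 * n) => Sum.elim p.1 p.2 (π.symm j)) with hN
  have hNlt : ∀ p, N p < 2 ^ (2 * n) := fun p => Nat.ofBits_lt_two_pow _
  have hNinj : Function.Injective N := by
    intro p q hpq
    obtain ⟨r, c, hrc⟩ := exists_cutPair_eq n π ⟨N q, hNlt q⟩
    -- read both pairs off the bits of the common value
    have hbits : ∀ p' : (Fin n → Bool) × (Fin n → Bool), N p' = N q →
        p' = (fun i => (N q).testBit (π (Sum.inl i)), fun i => (N q).testBit (π (Sum.inr i))) := by
      intro p' hp'
      ext i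
      · have := testBit_cutNumber' n π p'.1 p'.2 (π (Sum.inl i))
        simp only [Equiv.symm_apply_apply, Sum.elim_inl] at this
        rw [← hp', ← this]
      · have := testBit_cutNumber' n π p'.1 p'.2 (π (Sum.inr i))
        simp only [Equiv.symm_apply_apply, Sum.elim_inr] at this
        rw [← hp', ← this]
    exact (hbits p hpq).trans (hbits q rfl).symm
  -- Step 1: the double sum is a sum over the image set `S = N(A × B)`
  set f : ℕ → ℝ := fun m => ((liouville (m + 1) : ℤ) : ℝ) with hf
  have hsum1 : ∑ r ∈ A, ∑ c ∈ B, ((liouville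
      (Nat.ofBits (fun j : Fin (2 * n) => Sum.elim r c (π.symm j)) + 1) : ℤ) : ℝ) =
      ∑ m ∈ (A ×ˢ B).image N, f m := by
    rw [sum_image (fun p _ q _ h => hNinj h), sum_product]
  -- Step 2: `S` is the union of the aligned `2^L`-blocks over `𝓗 = {⌊N/2^L⌋}`
  set 𝓗 : Finset ℕ := (A ×ˢ B).image fun p => N p / 2 ^ L with h𝓗
  set blk : ℕ → Finset ℕ := fun H => (range (2 ^ L)).image fun a => 2 ^ L * H + a with hblk
  have hcover : (A ×ˢ B).image N = 𝓗.biUnion blk := by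
    ext m
    simp only [mem_image, mem_biUnion, mem_product, h𝓗, hblk, mem_range]
    constructor
    · rintro ⟨p, hp, rfl⟩
      exact ⟨N p / 2 ^ L, ⟨p, hp, rfl⟩, N p % 2 ^ L, Nat.mod_lt _ (Nat.two_pow_pos L),
        Nat.div_add_mod (N p) (2 ^ L)⟩
    · rintro ⟨H, ⟨p, ⟨hpA, hpB⟩, rfl⟩, a, ha, rfl⟩
      -- the number `m = 2^L (N p / 2^L) + a` is `N p'` for a pair `p'` agreeing with `p` above `L`
      have hm : 2 ^ L * (N p / 2 ^ L) + a < 2 ^ (2 * n) := by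
        have h1 : 2 ^ L * (N p / 2 ^ L) ≤ N p := Nat.mul_div_le (N p) (2 ^ L)
        have h2 : N p / 2 ^ L < 2 ^ (2 * n - L) := by
          rw [Nat.div_lt_iff_lt_mul (Nat.two_pow_pos L), ← pow_add]
          exact lt_of_lt_of_le (hNlt p) (Nat.pow_le_pow_right Nat.two_pos (by omega))
        have h3 : 2 ^ L * (N p / 2 ^ L) + a < 2 ^ L * (N p / 2 ^ L + 1) := by
          rw [Nat.mul_succ]; omega
        calc 2 ^ L * (N p / 2 ^ L) + a < 2 ^ L * (N p / 2 ^ L + 1) := h3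
          _ ≤ 2 ^ L * 2 ^ (2 * n - L) := Nat.mul_le_mul_left _ h2
          _ = 2 ^ (2 * n) := by rw [← pow_add]; congr 1; omega
      obtain ⟨r', c', hrc'⟩ := exists_cutPair_eq n π ⟨_, hm⟩
      have hval : N (r', c') = 2 ^ L * (N p / 2 ^ L) + a := congrArg Fin.val hrc'
      -- bits above `L` agree with those of `N p`
      have hhigh : ∀ j : Fin (2 * n), L ≤ (j : ℕ) →
          Sum.elim r' c' (π.symm j) = Sum.elim p.1 p.2 (π.symm j) := by
        intro j hj
        rw [← testBit_cutNumber' n π r' c' j, ← testBit_cutNumber' n π p.1 p.2 j]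
        change (N (r', c')).testBit j = (N p).testBit j
        rw [hval, Nat.testBit_two_pow_mul_add _ ha, if_neg (by omega), Nat.testBit_div_two_pow]
        congr 1; omega
      refine ⟨(r', c'), ⟨?_, ?_⟩, hval⟩
      · refine hA p.1 hpA r' fun i hi => ?_
        have := hhigh (π (Sum.inl i)) hi
        simpa using this
      · refine hB p.2 hpB c' fun i hi => ?_
        have := hhigh (π (Sum.inr i)) hi
        simpa using this
  -- Step 3: sum block by block
  have hdisj : (𝓗 : Set ℕ).PairwiseDisjoint blk := by
    intro H _ H' _ hne
    rw [Function.onFun, disjoint_left]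
    intro m hm hm'
    simp only [hblk, mem_image, mem_range] at hm hm'
    obtain ⟨a, ha, rfl⟩ := hm
    obtain ⟨a', ha', h⟩ := hm'
    apply hne
    have h1 : (2 ^ L * H + a) / 2 ^ L = H := by
      rw [Nat.mul_add_div (Nat.two_pow_pos L), Nat.div_eq_of_lt ha, add_zero]
    have h2 : (2 ^ L * H' + a') / 2 ^ L = H' := by
      rw [Nat.mul_add_div (Nat.two_pow_pos L), Nat.div_eq_of_lt ha', add_zero]
    rw [← h1, ← h2, h]
  have hsum2 : ∑ m ∈ (A ×ˢ B).image N, f m =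
      ∑ H ∈ 𝓗, ∑ a ∈ range (2 ^ L), f (2 ^ L * H + a) := by
    rw [hcover, sum_biUnion hdisj]
    refine sum_congr rfl fun H _ => ?_
    rw [hblk, sum_image]
    intro a _ a' _ h
    exact Nat.add_left_cancel h
  -- Step 4: Matomäki–Radziwiłł on the aligned blocks `H < 2^{2n - L}`
  have h𝓗sub : 𝓗 ⊆ range (2 ^ (2 * n - L)) := by
    intro H hH
    simp only [h𝓗, mem_image] at hH
    obtain ⟨p, -, rfl⟩ := hH
    rw [mem_range, Nat.div_lt_iff_lt_mul (Nat.two_pow_pos L), ← pow_add]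
    exact lt_of_lt_of_le (hNlt p) (Nat.pow_le_pow_right Nat.two_pos (by omega))
  have hMR := hL L le_rfl (2 ^ (2 * n - L))
  rw [hsum1, hsum2]
  calc |∑ H ∈ 𝓗, ∑ a ∈ range (2 ^ L), f (2 ^ L * H + a)|
      ≤ ∑ H ∈ 𝓗, |∑ a ∈ range (2 ^ L), f (2 ^ L * H + a)| := abs_sum_le_sum_abs _ _
    _ ≤ ∑ H ∈ range (2 ^ (2 * n - L)), |∑ a ∈ range (2 ^ L), f (2 ^ L * H + a)| :=
        sum_le_sum_of_subset_of_nonneg h𝓗sub fun _ _ _ => abs_nonneg _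
    _ = ∑ H ∈ range (2 ^ (2 * n - L)), |∑ a ∈ range (2 ^ L), (liouville (a + 2 ^ L * H + 1) : ℝ)| := by
        refine sum_congr rfl fun H _ => ?_
        congr 1
        refine sum_congr rfl fun a _ => ?_
        simp only [hf, Nat.add_comm (2 ^ L * H) a]
    _ ≤ ε * 2 ^ L * (2 ^ (2 * n - L) : ℕ) := hMR
    _ = ε * 4 ^ n := by
        push_cast
        rw [mul_assoc, ← pow_add, Nat.add_sub_cancel' hLn, pow_mul]
        norm_num

end Summit.ValiantsHypothesis.ValiantsHypothesis.Theorems.LiouvilleSarnakDigitalBilinearLiouville.Coarse
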